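import Literature.Geometry.Riemannian.DistanceDistributionSphereComparison
import Literature.Geometry.Riemannian.HeatFlowDisplacement
import Mathlib.Analysis.SpecialFunctions.Integrals.Basic
import HarnessLib

/-!
# Second moments of `cos d_p` under almost maximal volume (Colding 1996a, §2)

On `Sⁿ`, `∫ cos² d_N = |Sⁿ|/(n+1)` (the coordinate functions are an orthonormal system of the
same norm). On a closed `n`-manifold with `Ric ≥ n − 1` Bishop's inequality for the law of `d_p`
(`lintegral_comp_riemannianEDist_le_mul_lintegral_sin_pow`) gives `∫ cos² d_p dμ ≤ |Sⁿ|/(n+1)`, and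
the almost-maximal-volume comparison (`mul_lintegral_sin_pow_le_lintegral_comp_riemannianEDist_add`)
gives `∫ cos² d_p dμ ≥ |Sⁿ|/(n+1) − δ|Sⁿ|` when `μ(M) ≥ (1 − δ)|Sⁿ|`. These are the second
moments entering the frame construction and the Parseval step of the Gromov–Hausdorff assembly
in Colding's volume sphere theorem (`Colding1996_volume_ghClose`).

* `integral_sin_pow_mul_cos_sq` — `∫₀^π sin^k t cos² t dt = (∫₀^π sin^k)/(k+2)`;
* `unitSphereVolume_mul_integral_sin_pow_mul_cos_sq` — `|S^{n−1}| ∫₀^π sin^{n−1}cos² = |Sⁿ|/(n+1)`;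
* `lintegral_cos_sq_riemannianEDist_le`, `integral_cos_sq_riemannianEDist_le` — the upper bound;
* `sub_le_integral_cos_sq_riemannianEDist` — the lower bound.

Everything here is proved; no definitions, no named facts (D-0026).

## References

* T. H. Colding, *Shape of manifolds with positive Ricci curvature*, Invent. Math. 124 (1996)
  175–191, §2. [Colding1996Shape]
* I. Chavel, *Riemannian geometry: a modern introduction* (2006), Thm. III.4.4. [Chavel2006]
-/

noncomputable section

open Bundle Set Function Filter MeasureTheory Manifold intervalIntegral
open scoped Manifold ContDiff Topology ENNReal

namespace Literature.Geometry.Riemannian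

open Lorentzian Lorentzian.PseudoRiemannianMetric

/-! ### The spherical second moment -/

/-- `∫₀^π sin^k t · cos² t dt = (∫₀^π sin^k t dt)/(k + 2)` (`cos² = 1 − sin²` and the reduction
formula `∫ sin^{k+2} = (k+1)/(k+2) ∫ sin^k`). [folklore] -/
theorem integral_sin_pow_mul_cos_sq (k : ℕ) :
    ∫ t in (0:ℝ)..Real.pi, Real.sin t ^ k * Real.cos t ^ 2 =
      (∫ t in (0:ℝ)..Real.pi, Real.sin t ^ k) / (k + 2) := by
  have h1 : (fun t ↦ Real.sin t ^ k * Real.cos t ^ 2) =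
      fun t ↦ Real.sin t ^ k - Real.sin t ^ (k + 2) := by
    funext t
    have hc : Real.cos t ^ 2 = 1 - Real.sin t ^ 2 := by linarith [Real.sin_sq_add_cos_sq t]
    rw [hc, pow_add]
    ring
  have hi1 : IntervalIntegrable (fun t ↦ Real.sin t ^ k) volume 0 Real.pi :=
    (Real.continuous_sin.pow k).intervalIntegrable _ _
  have hi2 : IntervalIntegrable (fun t ↦ Real.sin t ^ (k + 2)) volume 0 Real.pi :=
    (Real.continuous_sin.pow (k + 2)).intervalIntegrable _ _
  rw [h1, intervalIntegral.integral_sub hi1 hi2, integral_sin_pow]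
  simp only [Real.sin_zero, Real.sin_pi, zero_pow (Nat.succ_ne_zero k), zero_mul, sub_zero,
    zero_div, zero_add]
  have hk : (k : ℝ) + 2 ≠ 0 := by positivity
  field_simp
  ring

/-- `|S^{n−1}| ∫₀^π sin^{n−1} t cos² t dt = |Sⁿ|/(n+1)` for `n ≥ 1`: the second moment of a
coordinate function on the unit sphere. [folklore] -/
theorem unitSphereVolume_mul_integral_sin_pow_mul_cos_sq {n : ℕ} (hn : 1 ≤ n) :
    unitSphereVolume (n - 1) * ∫ t in (0:ℝ)..Real.pi, Real.sin t ^ (n - 1) * Real.cos t ^ 2 =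
      unitSphereVolume n / (n + 1) := by
  obtain ⟨k, rfl⟩ : ∃ k, n = k + 1 := ⟨n - 1, by omega⟩
  rw [Nat.add_sub_cancel, integral_sin_pow_mul_cos_sq k, unitSphereVolume_succ_eq_mul_integral_sin_pow k]
  push_cast
  ring

/-! ### On the manifold -/

section FactVocabulary

open Literature.Geometry.Lorentzian (riemannianMeasure)

variable (n : ℕ) (M : Type) [TopologicalSpace M] [T2Space M] [SecondCountableTopology M]
    [ChartedSpace (EuclideanSpace ℝ (Fin n)) M] [IsManifold (𝓡 n) ∞ M] [CompactSpace M]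
    [ConnectedSpace M] [MeasurableSpace M] [BorelSpace M]
    (h : Bundle.ContMDiffRiemannianMetric (𝓡 n) ∞ (EuclideanSpace ℝ (Fin n))
      (TangentSpace (𝓡 n) : M → Type _))
    [(PseudoRiemannianMetric.ofRiemannian h).HasLeviCivita]

/-- **`∫ cos² d_p dμ ≤ |Sⁿ|/(n+1)`** under `Ric ≥ (n−1)h` (Bishop's inequality for the law of
`d_p` applied to `φ = cos²`), `lintegral` form. [cite: Chavel2006, Thm. III.4.4]
[cite: Colding1996Shape, §2] -/
theorem lintegral_cos_sq_riemannianEDist_le (hn : 2 ≤ n)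
    (hRic : ∀ (x : M) (v : TangentSpace (𝓡 n) x),
      ((n : ℝ) - 1) * h.inner x v v ≤ (PseudoRiemannianMetric.ofRiemannian h).ricci x v v)
    (p : M) :
    ∫⁻ x, ENNReal.ofReal (Real.cos ((PseudoRiemannianMetric.ofRiemannian h).edist
        (PseudoRiemannianMetric.isRiemannian_ofRiemannian h) p x).toReal ^ 2) ∂riemannianMeasure h ≤
      ENNReal.ofReal (unitSphereVolume n / (n + 1)) := by
  have hφ : Measurable fun r : ℝ ↦ ENNReal.ofReal (Real.cos r ^ 2) :=
    ENNReal.measurable_ofReal.comp ((Real.continuous_cos.pow 2).measurable)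
  have key := lintegral_comp_riemannianEDist_le_mul_lintegral_sin_pow n hn M h hRic p hφ
  refine key.trans (le_of_eq ?_)
  have hn1 : 1 ≤ n := by omega
  rw [← unitSphereVolume_mul_integral_sin_pow_mul_cos_sq hn1,
    ENNReal.ofReal_mul (unitSphereVolume_pos _).le]
  congr 1
  have hcont : Continuous fun t : ℝ ↦ Real.sin t ^ (n - 1) * Real.cos t ^ 2 :=
    (Real.continuous_sin.pow _).mul (Real.continuous_cos.pow 2)
  have hnn : ∀ t ∈ Ioc (0:ℝ) Real.pi, 0 ≤ Real.sin t ^ (n - 1) * Real.cos t ^ 2 := fun t ht ↦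
    mul_nonneg (pow_nonneg (Real.sin_nonneg_of_nonneg_of_le_pi ht.1.le ht.2) _) (sq_nonneg _)
  rw [intervalIntegral.integral_of_le Real.pi_pos.le,
    ofReal_integral_eq_lintegral_ofReal (hcont.integrableOn_Icc.mono_set Ioc_subset_Icc_self)
      ((ae_restrict_iff' measurableSet_Ioc).2 (Eventually.of_forall hnn))]
  refine setLIntegral_congr_fun measurableSet_Ioc fun t ht ↦ ?_
  rw [ENNReal.ofReal_mul (pow_nonneg (Real.sin_nonneg_of_nonneg_of_le_pi ht.1.le ht.2) _)]

omit [SecondCountableTopology M] [(PseudoRiemannianMetric.ofRiemannian h).HasLeviCivita] in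
/-- `x ↦ cos²(d(p, x))` is continuous, bounded by `1` and integrable; its `lintegral` is the
`ofReal` of its integral. [folklore] -/
theorem lintegral_ofReal_cos_sq_riemannianEDist_eq (p : M) :
    ∫⁻ x, ENNReal.ofReal (Real.cos ((PseudoRiemannianMetric.ofRiemannian h).edist
        (PseudoRiemannianMetric.isRiemannian_ofRiemannian h) p x).toReal ^ 2) ∂riemannianMeasure h =
      ENNReal.ofReal (∫ x, Real.cos ((PseudoRiemannianMetric.ofRiemannian h).edist
        (PseudoRiemannianMetric.isRiemannian_ofRiemannian h) p x).toReal ^ 2 ∂riemannianMeasure h) := by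
  haveI : IsFiniteMeasure (riemannianMeasure h) :=
    ⟨riemannianVolume_lt_top_of_isCompact_holds h le_rfl isCompact_univ⟩
  have hc : Continuous fun x ↦ Real.cos ((PseudoRiemannianMetric.ofRiemannian h).edist
      (PseudoRiemannianMetric.isRiemannian_ofRiemannian h) p x).toReal ^ 2 :=
    (Real.continuous_cos.comp (continuous_edist_toReal _ _ p)).pow 2
  rw [ofReal_integral_eq_lintegral_ofReal (integrable_of_continuous h hc)
    (Eventually.of_forall fun x ↦ sq_nonneg _)]

/-- **`∫ cos² d_p dμ ≤ |Sⁿ|/(n+1)`**, real form. [cite: Chavel2006, Thm. III.4.4]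
[cite: Colding1996Shape, §2] -/
theorem integral_cos_sq_riemannianEDist_le (hn : 2 ≤ n)
    (hRic : ∀ (x : M) (v : TangentSpace (𝓡 n) x),
      ((n : ℝ) - 1) * h.inner x v v ≤ (PseudoRiemannianMetric.ofRiemannian h).ricci x v v)
    (p : M) :
    ∫ x, Real.cos ((PseudoRiemannianMetric.ofRiemannian h).edist
        (PseudoRiemannianMetric.isRiemannian_ofRiemannian h) p x).toReal ^ 2 ∂riemannianMeasure h ≤
      unitSphereVolume n / (n + 1) := by
  have key := lintegral_cos_sq_riemannianEDist_le n M h hn hRic p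
  rw [lintegral_ofReal_cos_sq_riemannianEDist_eq] at key
  exact (ENNReal.ofReal_le_ofReal_iff
    (div_nonneg (unitSphereVolume_pos n).le (by positivity))).1 key

/-- **`∫ cos² d_p dμ ≥ |Sⁿ|/(n+1) − δ|Sⁿ|` under `Ric ≥ (n−1)h` and `μ(M) ≥ (1−δ)|Sⁿ|`** (the
almost-maximal-volume law of `d_p`, `mul_lintegral_sin_pow_le_lintegral_comp_riemannianEDist_add`,
applied to `φ = cos²`). [cite: Colding1996Shape, §2] [cite: Colding1997Aspects, Thm. 2.2 (proof)] -/
theorem sub_le_integral_cos_sq_riemannianEDist (hn : 2 ≤ n)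
    (hRic : ∀ (x : M) (v : TangentSpace (𝓡 n) x),
      ((n : ℝ) - 1) * h.inner x v v ≤ (PseudoRiemannianMetric.ofRiemannian h).ricci x v v)
    {δ : ℝ} (hδ : 0 ≤ δ)
    (hvol : ENNReal.ofReal ((1 - δ) * unitSphereVolume n) ≤ riemannianMeasure h Set.univ)
    (p : M) :
    unitSphereVolume n / (n + 1) - δ * unitSphereVolume n ≤
      ∫ x, Real.cos ((PseudoRiemannianMetric.ofRiemannian h).edist
        (PseudoRiemannianMetric.isRiemannian_ofRiemannian h) p x).toReal ^ 2 ∂riemannianMeasure h := by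
  have hφ : Measurable fun r : ℝ ↦ ENNReal.ofReal (Real.cos r ^ 2) :=
    ENNReal.measurable_ofReal.comp ((Real.continuous_cos.pow 2).measurable)
  have hφ1 : ∀ r, ENNReal.ofReal (Real.cos r ^ 2) ≤ 1 := fun r ↦ by
    rw [← ENNReal.ofReal_one]
    exact ENNReal.ofReal_le_ofReal ((sq_le_one_iff_abs_le_one _).2 (Real.abs_cos_le_one r))
  have key := mul_lintegral_sin_pow_le_lintegral_comp_riemannianEDist_add n hn M h hRic hδ hvol p
    hφ hφ1
  have hn1 : 1 ≤ n := by omega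
  -- the left-hand side is `|Sⁿ|/(n+1)`
  have hcont : Continuous fun t : ℝ ↦ Real.sin t ^ (n - 1) * Real.cos t ^ 2 :=
    (Real.continuous_sin.pow _).mul (Real.continuous_cos.pow 2)
  have hnn : ∀ t ∈ Ioc (0:ℝ) Real.pi, 0 ≤ Real.sin t ^ (n - 1) * Real.cos t ^ 2 := fun t ht ↦
    mul_nonneg (pow_nonneg (Real.sin_nonneg_of_nonneg_of_le_pi ht.1.le ht.2) _) (sq_nonneg _)
  have hL : ENNReal.ofReal (unitSphereVolume (n - 1)) *
      ∫⁻ r in Ioc (0:ℝ) Real.pi, ENNReal.ofReal (Real.sin r ^ (n - 1)) * ENNReal.ofReal (Real.cos r ^ 2) =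
      ENNReal.ofReal (unitSphereVolume n / (n + 1)) := by
    rw [← unitSphereVolume_mul_integral_sin_pow_mul_cos_sq hn1,
      ENNReal.ofReal_mul (unitSphereVolume_pos _).le]
    congr 1
    rw [intervalIntegral.integral_of_le Real.pi_pos.le,
      ofReal_integral_eq_lintegral_ofReal (hcont.integrableOn_Icc.mono_set Ioc_subset_Icc_self)
        ((ae_restrict_iff' measurableSet_Ioc).2 (Eventually.of_forall hnn))]
    refine setLIntegral_congr_fun measurableSet_Ioc fun t ht ↦ ?_
    rw [ENNReal.ofReal_mul (pow_nonneg (Real.sin_nonneg_of_nonneg_of_le_pi ht.1.le ht.2) _)]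
  rw [hL] at key
  change ENNReal.ofReal (unitSphereVolume n / (n + 1)) ≤
    ∫⁻ x, ENNReal.ofReal (Real.cos ((PseudoRiemannianMetric.ofRiemannian h).edist
        (PseudoRiemannianMetric.isRiemannian_ofRiemannian h) p x).toReal ^ 2) ∂riemannianMeasure h +
      ENNReal.ofReal (δ * unitSphereVolume n) at key
  rw [lintegral_ofReal_cos_sq_riemannianEDist_eq,
    ← ENNReal.ofReal_add (integral_nonneg fun x ↦ sq_nonneg _)
      (mul_nonneg hδ (unitSphereVolume_pos n).le),
    ENNReal.ofReal_le_ofReal_iff (add_nonneg (integral_nonneg fun x ↦ sq_nonneg _)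
      (mul_nonneg hδ (unitSphereVolume_pos n).le))] at key
  linarith

end FactVocabulary

end Literature.Geometry.Riemannian

end
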